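import Summits.AtomisticToContinuum.HydrodynamicLimit.Theorems.CollisionIsometryCLTDiffuseBackwardInfluenceStickLD
import Literature.Analysis.FluidPDE.HardSphereTorusMeasure
import HarnessLib

/-!
# Vocabulary for the proof of `FewIdle.StickSupersat` (the 7/3 crossing-energy law for random sticks)
(crux `DiffuseBackwardInfluence`, stmt-AtomisticToContinuum-12950, line `share-nondegeneracy-one-flight`; lead prover,
continuation c2; definitions-only support file carrying the registered dictionary sub-goal `cross_iff_posAt`)

The registered stub `stub_stickLD` is reduced (`stickLD_of_supersat`, `…StickLD.lean`) to the deterministic inequality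
`FewIdle.StickSupersat σ θ`: for measurable `S ⊆ 𝕋³ × ℝ³` with `μ₁(S) ≥ ρ` (`μ₁ = oneStickLaw θ`),
`∫_S μ₁(shadow_τ(z) ∩ S) dμ₁(z) ≥ c₁ ε² τ ρ^{4/3} μ₁(S)`. Its proof (continuation lead c1's occupation-time argument,
`Cruxes/DiffuseBackwardInfluence/NOTES.md` §9) uses three objects, defined here so that the three registered sub-goals
`occ_fast_bound`, `fixedTime_bound_reg`, `slow_time_integral_bound` and the stub `stub_stickSupersat` can each land in
its own file with the registered signature verbatim:

* `FewIdle.Supersat.posAt r z` — the straight position `x + r v` (mod 1) of the stick `z = (x, v)` at time `r`;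
* `FewIdle.Supersat.occ ε τ z z'` — the OCCUPATION TIME: the Lebesgue measure of the set of times `r ∈ [0, τ]` at
  which the two sticks are at minimal-image distance `< ε` (positive occupation time implies crossing, and for relative
  speed `≥ w₀` it is `≤ 2ε(τ + 2√3/w₀)`);
* `FewIdle.Supersat.slowNear ε w₀ z z' r` — the `ℝ≥0∞`-indicator that `z'` is a SLOW (`‖v − v'‖ < w₀`) partner of `z`
  at distance `< ε` at time `r`.

Dictionary: `crossDist ((z, z'), r) = euclidDist (posAt r z) (posAt r z')` (`rfl`) and
`Cross ε τ z z' ↔ ∃ r ∈ [0, τ], euclidDist (posAt r z) (posAt r z') < ε` (`cross_iff_posAt`, registered).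
Nothing is asserted here.
-/

namespace Summit.AtomisticToContinuum.HydrodynamicLimit.Theorems.DiffuseBackwardInfluenceShare

open scoped BigOperators Topology ENNReal Classical
open Filter Set MeasureTheory
open Literature.Analysis.FluidPDE
open Summit.AtomisticToContinuum.HydrodynamicLimit.Theorems.DiffuseBackwardInfluenceNeg

noncomputable section

namespace FewIdle

namespace Supersat

/-- The straight position of the stick `z = (x, v)` at time `r`: `x + r v` projected to the torus. -/
def posAt (r : ℝ) (z : T3 × V3) : T3 :=
  z.1 + Literature.Analysis.FunctionSpaces.Torus.proj (r • z.2)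

/-- The OCCUPATION TIME of two sticks at thickness `ε` during `[0, τ]`: the Lebesgue measure of the set of times at
which their straight positions are at minimal-image distance `< ε`. -/
def occ (ε τ : ℝ) (z z' : T3 × V3) : ℝ≥0∞ :=
  volume {r : ℝ | r ∈ Set.Icc (0 : ℝ) τ ∧ Torus.euclidDist (posAt r z) (posAt r z') < ε}

/-- The `ℝ≥0∞`-indicator that `z'` is a SLOW partner of `z` (`‖v − v'‖ < w₀`) at minimal-image distance `< ε` at
time `r`. -/
def slowNear (ε w₀ : ℝ) (z z' : T3 × V3) (r : ℝ) : ℝ≥0∞ :=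
  {q : (T3 × V3) × ℝ | ‖z.2 - q.1.2‖ < w₀ ∧ Torus.euclidDist (posAt q.2 z) (posAt q.2 q.1) < ε}.indicator 1 (z', r)

/-- `posAt 0 z = z.1`. [folklore] -/
@[simp] theorem posAt_zero (z : T3 × V3) : posAt 0 z = z.1 := by
  simp [posAt]

/-- Dictionary: the crossing distance of `…StickLD.lean` is the minimal-image distance of the straight positions.
[folklore] -/
theorem crossDist_eq_euclidDist_posAt (z z' : T3 × V3) (r : ℝ) :
    crossDist ((z, z'), r) = Torus.euclidDist (posAt r z) (posAt r z') := rfl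

/-- `slowNear` unfolded as an `if`. [folklore] -/
theorem slowNear_eq_ite (ε w₀ : ℝ) (z z' : T3 × V3) (r : ℝ) :
    slowNear ε w₀ z z' r =
      if ‖z.2 - z'.2‖ < w₀ ∧ Torus.euclidDist (posAt r z) (posAt r z') < ε then 1 else 0 := by
  unfold slowNear
  by_cases h : ‖z.2 - z'.2‖ < w₀ ∧ Torus.euclidDist (posAt r z) (posAt r z') < ε
  · rw [indicator_of_mem (by exact h), if_pos h]; rfl
  · rw [indicator_of_notMem (by exact h), if_neg h]

/-- `slowNear ≤ 1`. [folklore] -/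
theorem slowNear_le_one (ε w₀ : ℝ) (z z' : T3 × V3) (r : ℝ) : slowNear ε w₀ z z' r ≤ 1 := by
  rw [slowNear_eq_ite]; split_ifs <;> simp

/-- The occupation time is at most the duration. [folklore] -/
theorem occ_le (ε τ : ℝ) (z z' : T3 × V3) : occ ε τ z z' ≤ ENNReal.ofReal τ := by
  unfold occ
  calc volume {r : ℝ | r ∈ Set.Icc (0 : ℝ) τ ∧ Torus.euclidDist (posAt r z) (posAt r z') < ε}
      ≤ volume (Set.Icc (0 : ℝ) τ) := measure_mono fun r hr => hr.1
    _ = ENNReal.ofReal τ := by rw [Real.volume_Icc, sub_zero]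

/-- Positive occupation time implies crossing. [folklore] -/
theorem cross_of_occ_ne_zero {ε τ : ℝ} {z z' : T3 × V3} (h : occ ε τ z z' ≠ 0) : Cross ε τ z z' := by
  obtain ⟨r, hr⟩ := nonempty_of_measure_ne_zero h
  exact ⟨r, hr.1, hr.2⟩

end Supersat

/-- Dictionary (registered sub-goal `cross_iff_posAt` of the crux item): two sticks cross iff at some time of `[0, τ]`
their straight positions are at minimal-image distance `< ε`. [folklore] -/
theorem cross_iff_posAt : ∀ (ε τ : ℝ) (z z' : T3 × V3), FewIdle.Cross ε τ z z' ↔ ∃ r ∈ Set.Icc (0 : ℝ) τ, Torus.euclidDist (FewIdle.Supersat.posAt r z) (FewIdle.Supersat.posAt r z') < ε :=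
  fun _ _ _ _ => Iff.rfl

end FewIdle

end

end Summit.AtomisticToContinuum.HydrodynamicLimit.Theorems.DiffuseBackwardInfluenceShare
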